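import Literature.NumberTheory.Automorphic.LocalOrbitalIntegral
import Literature.Topology.CompactOpenDisjointRefinement
import HarnessLib

/-!
# Orbital integrals are additive over finite sums and over the pieces of a test function

Topic `NumberTheory/Automorphic`; namespace `Literature.NumberTheory.Automorphic`. THEOREMS ONLY
(no definition, no instance, no named fact, no `sorry`).

Rogawski (1990), §4.9 p. 54: the orbital integral `Φ(γ, f) = ∫_{G_γ \ G} f(g⁻¹ γ g) dg` is linear
in `f`. The tree's named functional `orbitalIntegral γ f m` (`LocalOrbitalIntegral`) has
`orbitalIntegral_add`; here we record the FINITE-SUM form and combine it with Bernstein–Zelevinsky's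
Lemma 1.1 (`Literature.Topology.CompactOpenDisjointRefinement`): a test function supported in a
disjoint union `⋃ j, V j` of compact open sets is the sum of its pieces `1_{V j} · f`, hence
`O_γ(f) = ∑ j, O_γ(1_{V j} · f)` (`orbitalIntegral_eq_sum_orbitalIntegral_indicator`), and the
same for the class function `classOrbitalIntegral`. This is the generic step that reduces statements
additive in `f` (orbital-integral identities, transfer of regular-support test functions) to test
functions supported in ONE chart.

## References

* [Rogawski1990] J. Rogawski, *Automorphic representations of unitary groups in three variables*,
  Ann. of Math. Stud. 123 (1990), §4.9 p. 54.
* [BernsteinZelevinsky1976] I. N. Bernstein, A. V. Zelevinsky, Russian Math. Surveys 31:3 (1976),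
  §1.1, Lemma 1.1.
-/

noncomputable section

open MeasureTheory Set Filter Function
open Literature.MeasureTheory.Group Literature.Topology
open scoped BigOperators

namespace Literature.NumberTheory.Automorphic

section DescConj

variable {G : Type*} [Group G] {E : Type*} [AddCommMonoid E] (γ : G)

/-- The orbital integrand of a finite sum is the finite sum of the orbital integrands (pointwise).
[cite: Rogawski1990, §4.9 p. 54] -/
theorem descConj_finset_sum {ι : Type*} (s : Finset ι) (f : ι → G → E) :
    descConj γ (Subgroup.centralizer ({γ} : Set G)) (fun _ hg => Subgroup.mem_centralizer_singleton_iff.1 hg)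
        (∑ i ∈ s, f i) =
      ∑ i ∈ s, descConj γ (Subgroup.centralizer ({γ} : Set G))
        (fun _ hg => Subgroup.mem_centralizer_singleton_iff.1 hg) (f i) := by
  funext y
  induction y using QuotientGroup.induction_on with
  | H x => simp only [descConj_mk, Finset.sum_apply]

end DescConj

section FinsetSum

variable {G : Type*} [Group G] {E : Type*} [NormedAddCommGroup E] [NormedSpace ℝ E]
variable (γ : G) [MeasurableSpace (G ⧸ Subgroup.centralizer ({γ} : Set G))]
  (m : Measure (G ⧸ Subgroup.centralizer ({γ} : Set G)))

/-- **Finite additivity** `O_γ(∑ i ∈ s, f i) = ∑ i ∈ s, O_γ(f i)` when every orbital integrand is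
integrable. [cite: Rogawski1990, §4.9 p. 54] -/
theorem orbitalIntegral_finset_sum {ι : Type*} (s : Finset ι) (f : ι → G → E)
    (hf : ∀ i ∈ s, Integrable (descConj γ (Subgroup.centralizer ({γ} : Set G))
      (fun _ hg => Subgroup.mem_centralizer_singleton_iff.1 hg) (f i)) m) :
    orbitalIntegral γ (∑ i ∈ s, f i) m = ∑ i ∈ s, orbitalIntegral γ (f i) m := by
  simp only [orbitalIntegral_eq_integral_descConj]
  rw [← integral_finsetSum s hf]
  refine integral_congr_ae (Eventually.of_forall fun y => ?_)
  rw [descConj_finset_sum, Finset.sum_apply]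

/-- **Finite additivity of the class function** `c ↦ O_{γ_c}(f)`:
`classOrbitalIntegral m (∑ i ∈ s, f i) c = ∑ i ∈ s, classOrbitalIntegral m (f i) c` when every orbital
integrand at `out c` is integrable. [cite: Rogawski1990, §4.9 p. 54] -/
theorem classOrbitalIntegral_finset_sum
    [∀ γ : G, MeasurableSpace (G ⧸ Subgroup.centralizer ({γ} : Set G))] (mf : OrbitalMeasureFamily G)
    {ι : Type*} (s : Finset ι) (f : ι → G → E) (c : ConjClasses G)
    (hf : ∀ i ∈ s, Integrable (descConj (Quotient.out c) (Subgroup.centralizer ({(Quotient.out c : G)} : Set G))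
      (fun _ hg => Subgroup.mem_centralizer_singleton_iff.1 hg) (f i)) (mf c)) :
    classOrbitalIntegral mf (∑ i ∈ s, f i) c = ∑ i ∈ s, classOrbitalIntegral mf (f i) c := by
  simp only [classOrbitalIntegral_eq]
  exact orbitalIntegral_finset_sum (Quotient.out c) (mf c) s f hf

end FinsetSum

section Pieces

variable {G : Type*} [Group G] {E : Type*} [NormedAddCommGroup E] [NormedSpace ℝ E]
variable (γ : G) [MeasurableSpace (G ⧸ Subgroup.centralizer ({γ} : Set G))]
  (m : Measure (G ⧸ Subgroup.centralizer ({γ} : Set G)))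

/-- **`O_γ(f) = ∑ j, O_γ(1_{V j} · f)` for `f` supported in a finite disjoint union `⋃ j, V j`**, when
the orbital integrands of the pieces are integrable (Bernstein–Zelevinsky's decomposition
`f = ∑ j, 1_{V j} · f` fed into finite additivity). [cite: Rogawski1990, §4.9 p. 54] -/
theorem orbitalIntegral_eq_sum_orbitalIntegral_indicator {n : ℕ} (V : Fin n → Set G)
    (hVd : Pairwise (Disjoint on V)) (f : G → E) (hf : support f ⊆ ⋃ j, V j)
    (hint : ∀ j, Integrable (descConj γ (Subgroup.centralizer ({γ} : Set G))
      (fun _ hg => Subgroup.mem_centralizer_singleton_iff.1 hg) ((V j).indicator f)) m) :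
    orbitalIntegral γ f m = ∑ j, orbitalIntegral γ ((V j).indicator f) m := by
  have hdec : f = ∑ j, (V j).indicator f := by
    funext x
    rw [Finset.sum_apply]
    exact (sum_indicator_apply_eq_of_subset_iUnion V hVd f hf x).symm
  conv_lhs => rw [hdec]
  exact orbitalIntegral_finset_sum γ m Finset.univ (fun j => (V j).indicator f) fun j _ => hint j

/-- The class-function form: `classOrbitalIntegral m f c = ∑ j, classOrbitalIntegral m (1_{V j} · f) c`
for `f` supported in the disjoint union `⋃ j, V j`, the pieces' orbital integrands at `out c` being
integrable. [cite: Rogawski1990, §4.9 p. 54] -/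
theorem classOrbitalIntegral_eq_sum_classOrbitalIntegral_indicator
    [∀ γ : G, MeasurableSpace (G ⧸ Subgroup.centralizer ({γ} : Set G))] (mf : OrbitalMeasureFamily G)
    {n : ℕ} (V : Fin n → Set G) (hVd : Pairwise (Disjoint on V)) (f : G → E)
    (hf : support f ⊆ ⋃ j, V j) (c : ConjClasses G)
    (hint : ∀ j, Integrable (descConj (Quotient.out c) (Subgroup.centralizer ({(Quotient.out c : G)} : Set G))
      (fun _ hg => Subgroup.mem_centralizer_singleton_iff.1 hg) ((V j).indicator f)) (mf c)) :
    classOrbitalIntegral mf f c = ∑ j, classOrbitalIntegral mf ((V j).indicator f) c := by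
  simp only [classOrbitalIntegral_eq]
  exact orbitalIntegral_eq_sum_orbitalIntegral_indicator (Quotient.out c) (mf c) V hVd f hf hint

/-- **The orbital integral of a piece vanishes at `γ` if no conjugate of `γ` lies in the (compact,
closed) piece**: `O_γ(1_V · f) = 0` when `g γ g⁻¹ ∉ V` for all `g` (Hausdorff topological group, `V`
compact). [cite: Rogawski1990, §4.9 p. 54] -/
theorem orbitalIntegral_indicator_eq_zero_of_forall_conj_notMem [TopologicalSpace G] [T2Space G]
    {V : Set G} (hV : IsCompact V) (f : G → E) (h : ∀ g : G, g * γ * g⁻¹ ∉ V) :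
    orbitalIntegral γ (V.indicator f) m = 0 :=
  orbitalIntegral_eq_zero_of_forall_notMem_tsupport γ m fun g hg =>
    h g (tsupport_indicator_subset_of_isCompact hV f hg)

end Pieces

section TestFunctions

variable {G : Type*} [Group G] [TopologicalSpace G] [T2Space G] [TotallyDisconnectedSpace G]
  [LocallyCompactSpace G] {E : Type*} [NormedAddCommGroup E] [NormedSpace ℝ E]

/-- **Regular-support reduction to one chart.** `G` a Hausdorff, locally compact, totally disconnected
group; `f : G → E` locally constant with compact support covered by open sets `U i` (charts). Then
`f = ∑ j, f_j` with finitely many locally constant compactly supported pieces `f_j = 1_{V j} · f`, the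
`V j` pairwise disjoint nonempty compact open sets each inside one `U i`, `tsupport f_j ⊆ V j`, and for
every `γ` and every measure `m` on `G ⧸ C(γ)` making the pieces' orbital integrands integrable,
`O_γ^m(f) = ∑ j, O_γ^m(f_j)`. [cite: BernsteinZelevinsky1976, §1.1] -/
theorem exists_pieces_orbitalIntegral_eq_sum {ι : Type*} {f : G → E} (hflc : IsLocallyConstant f)
    (hfc : HasCompactSupport f) (U : ι → Set G) (hU : ∀ i, IsOpen (U i))
    (hfU : tsupport f ⊆ ⋃ i, U i) :
    ∃ (n : ℕ) (V : Fin n → Set G), (∀ j, IsCompact (V j) ∧ IsOpen (V j) ∧ (V j).Nonempty ∧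
      ∃ i, V j ⊆ U i) ∧ Pairwise (Disjoint on V) ∧ tsupport f ⊆ ⋃ j, V j ∧
      (f = fun x => ∑ j, (V j).indicator f x) ∧
      (∀ j, IsLocallyConstant ((V j).indicator f) ∧ HasCompactSupport ((V j).indicator f) ∧
        tsupport ((V j).indicator f) ⊆ V j) ∧
      ∀ (γ : G) [MeasurableSpace (G ⧸ Subgroup.centralizer ({γ} : Set G))]
        (m : Measure (G ⧸ Subgroup.centralizer ({γ} : Set G))),
        (∀ j, Integrable (descConj γ (Subgroup.centralizer ({γ} : Set G))
          (fun _ hg => Subgroup.mem_centralizer_singleton_iff.1 hg) ((V j).indicator f)) m) →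
        orbitalIntegral γ f m = ∑ j, orbitalIntegral γ ((V j).indicator f) m := by
  obtain ⟨n, V, hV, hVd, hfV, hdec, hpieces⟩ :=
    exists_finite_sum_indicator_compactOpen_subordinate hflc hfc U hU hfU
  refine ⟨n, V, hV, hVd, hfV, hdec, hpieces, fun γ _ m hint => ?_⟩
  exact orbitalIntegral_eq_sum_orbitalIntegral_indicator γ m V hVd f
    ((subset_tsupport f).trans hfV) hint

end TestFunctions

end Literature.NumberTheory.Automorphic
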